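import Summits.MatrixMultiplication.OmegaCensus.DominoZpZpStructSixCheck
import Summits.MatrixMultiplication.OmegaCensus.DominoZpZpStructFiveGen
import HarnessLib

/-!
# Structural cover theorem for part size `6` on `ZMod p × ZMod p` (`p ≤ 13`): normalised tuples, table check, assembly

ω-census `pub-omega`, family (b3), seat pub-omega-group gen 23.  Framing: lottery ticket; floor = certified bounds/negative
ranges.  VALUE: with `DominoZpZpStructSixKeys/Core/Check.lean`, a kernel route to the part-`6` cells of the `ℤ_p²` column for
`p ≤ 13` — the OPEN census cell `(1,6,47)@847` (`p = 11`) — from a table of the `≈ p⁴/12` normalised repeated count vectors that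
are not excluded; NOT progress on ω.  Pattern of `DominoZpZpStructFive.lean`.

A GOOD sextuple of line values (`exists_goodS`: `a₀ = a₁`, key not in `E`) scaled by a unit is one of the NORMALISED REPEATED
tuples `(1,1,b,c,d,e)`, `(0,0,1,c,d,e)`, `(0,0,0,1,d,e)`, `(0,0,0,0,1,e)`, `(0,0,0,0,0,1)`, `0` with a non-excluded count vector;
`checkSix p et tt` (by rows `checkSixRow p et tt b`, `p³` lookups each, + `checkSixRest`) checks that every such tuple is excluded
(code `polyBE 7` in the SOUND code tree `et` of `E`) or a key of the table tree; `exists_entry_structSix_of_checks` delivers the scaled cover hypothesis for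
`|X| = 6` consumed by `DominoZpZpCells.no_law_cube_1de_of_onto_zpzp_of_cover`.
-/

namespace Summit.MatrixMultiplication.OmegaCensus

open Finset

namespace ZpZpDomino

/-! ## Normalised repeated tuples, the table check, and its soundness -/

section Table

/-- One normalised tuple is fine if its count-vector code is excluded (in the code tree `et` of the excluded list) or a key of the
table tree `tt`. [folklore] -/
def okSix (p : ℕ) (et tt : BTree) (n₀ n₁ n₂ n₃ n₄ n₅ : ℕ) : Bool :=
  let cd := hornerS 7 (cv6 p n₀ n₁ n₂ n₃ n₄ n₅) 0
  et.mem cd || tt.mem cd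

/-- Row `b` of the completeness check: the tuples `(1,1,b,c,d,e)`, `c, d, e < p`. [folklore] -/
def checkSixRow (p : ℕ) (et tt : BTree) (b : ℕ) : Bool :=
  (List.range p).all fun c => (List.range p).all fun d => (List.range p).all fun e => okSix p et tt 1 1 b c d e

/-- The remaining normalised tuples `(0,0,1,c,d,e)`, `(0,0,0,1,d,e)`, `(0,0,0,0,1,e)`, `(0,0,0,0,0,1)`, `0`. [folklore] -/
def checkSixRest (p : ℕ) (et tt : BTree) : Bool :=
  ((List.range p).all fun c => (List.range p).all fun d => (List.range p).all fun e => okSix p et tt 0 0 1 c d e) &&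
    (((List.range p).all fun d => (List.range p).all fun e => okSix p et tt 0 0 0 1 d e) &&
      (((List.range p).all fun e => okSix p et tt 0 0 0 0 1 e) && (okSix p et tt 0 0 0 0 0 1 && okSix p et tt 0 0 0 0 0 0)))

/-- **Completeness check** (`p⁴ + p³ + p² + p + 2` lookups). [folklore] -/
def checkSix (p : ℕ) (et tt : BTree) : Bool :=
  ((List.range p).all fun b => checkSixRow p et tt b) && checkSixRest p et tt

/-- Assembling `checkSix` from its rows. [folklore] -/
theorem checkSix_of_rows {p : ℕ} {et tt : BTree} (hrows : ∀ b < p, checkSixRow p et tt b = true)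
    (hrest : checkSixRest p et tt = true) : checkSix p et tt = true := by
  rw [checkSix, Bool.and_eq_true, List.all_eq_true]
  exact ⟨fun b hb => hrows b (List.mem_range.1 hb), hrest⟩

/-- Well-formedness of the excluded list (lengths `p`, digits `< 7`). [folklore] -/
def checkEwf6 (p : ℕ) (E : List (List ℕ)) : Bool := E.all fun k => (k.length == p) && k.all fun x => decide (x < 7)

/-- Entries of excluded keys are `≤ 3`. [folklore] -/
def checkE1six (E : List (List ℕ)) : Bool := E.all fun k => k.all fun x => decide (x ≤ 3)

/-- `checkE1six` ⇒ `hE1`. [folklore] -/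
theorem hE1six_of_check {E : List (List ℕ)} (h : checkE1six E = true) : ∀ k ∈ E, ∀ x ∈ k, x ≤ 3 := by
  intro k hk x hx
  simp only [checkE1six, List.all_eq_true, decide_eq_true_eq] at h
  exact h k hk x hx

/-- **A successful lookup yields a table entry with that key.** [folklore] -/
theorem entry_of_lookup6 {p : ℕ} {T : List (List ℕ × List (ℕ × List ℕ))} {tt : BTree}
    (htt : ∀ x, tt.mem x = true → x ∈ T.map fun e => polyBE 7 e.1) (hWF : tabWF p 7 T = true) {n₀ n₁ n₂ n₃ n₄ n₅ : ℕ}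
    (h : tt.mem (hornerS 7 (cv6 p n₀ n₁ n₂ n₃ n₄ n₅) 0) = true) : ∃ e ∈ T, e.1 = cv6 p n₀ n₁ n₂ n₃ n₄ n₅ := by
  rw [hornerS_zero] at h
  have h2 := htt _ h
  rw [List.mem_map] at h2
  obtain ⟨e, he, hcode⟩ := h2
  simp only [tabWF, List.all_eq_true, Bool.and_eq_true, beq_iff_eq, decide_eq_true_eq] at hWF
  obtain ⟨helen, hedig⟩ := hWF e he
  refine ⟨e, he, polyBE_inj (by rw [helen, length_cv6]) hedig (fun x hx => ?_) hcode⟩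
  simp only [cv6, List.mem_map, List.mem_range] at hx
  obtain ⟨w, -, rfl⟩ := hx
  exact Nat.lt_succ_of_le (cnt6_le _ _ _ _ _ _ _)

/-- From `excluded-or-found` and `not excluded` to `found` (`et` sound for the codes of `E`). [folklore] -/
theorem lookup6_of_not_exc {p : ℕ} {E : List (List ℕ)} (hEwf : checkEwf6 p E = true) {et tt : BTree}
    (hEt' : ∀ x, et.mem x = true → x ∈ E.map (polyBE 7)) {n₀ n₁ n₂ n₃ n₄ n₅ : ℕ} (hk : cv6 p n₀ n₁ n₂ n₃ n₄ n₅ ∉ E)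
    (h : okSix p et tt n₀ n₁ n₂ n₃ n₄ n₅ = true) :
    tt.mem (hornerS 7 (cv6 p n₀ n₁ n₂ n₃ n₄ n₅) 0) = true := by
  rw [okSix] at h
  simp only [Bool.or_eq_true, hornerS_zero] at h ⊢
  refine h.resolve_left fun hc => hk ?_
  have hc' := hEt' _ hc
  rw [List.mem_map] at hc'
  obtain ⟨k, hkE, hcode⟩ := hc'
  simp only [checkEwf6, List.all_eq_true, Bool.and_eq_true, beq_iff_eq, decide_eq_true_eq] at hEwf
  obtain ⟨hlen, hdig⟩ := hEwf k hkE
  have e : k = cv6 p n₀ n₁ n₂ n₃ n₄ n₅ :=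
    polyBE_inj (by rw [hlen, length_cv6]) hdig (fun x hx => by
      simp only [cv6, List.mem_map, List.mem_range] at hx
      obtain ⟨w, -, rfl⟩ := hx
      exact Nat.lt_succ_of_le (cnt6_le _ _ _ _ _ _ _)) hcode
  exact e ▸ hkE

variable {p : ℕ} [Fact p.Prime]

/-- The scaled count function read at `κ·v`. [folklore] -/
theorem cnt6_scaled {κ : ZMod p} (hκ : κ ≠ 0) (a₀ a₁ a₂ a₃ a₄ a₅ v : ZMod p) :
    cnt6 (κ * a₀).val (κ * a₁).val (κ * a₂).val (κ * a₃).val (κ * a₄).val (κ * a₅).val (κ * v).val =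
      (if a₀ = v then 1 else 0) + (if a₁ = v then 1 else 0) + (if a₂ = v then 1 else 0) + (if a₃ = v then 1 else 0) +
        (if a₄ = v then 1 else 0) + (if a₅ = v then 1 else 0) := by
  unfold cnt6
  simp only [(ZMod.val_injective p).eq_iff, mul_right_inj' hκ]

/-- From a table entry keyed by the scaled values to the count identity at every `v`. [folklore] -/
theorem getD_entry_scaled6 {κ : ZMod p} (hκ : κ ≠ 0) (a₀ a₁ a₂ a₃ a₄ a₅ : ZMod p) {e : List ℕ × List (ℕ × List ℕ)}
    (he : e.1 = cv6 p (κ * a₀).val (κ * a₁).val (κ * a₂).val (κ * a₃).val (κ * a₄).val (κ * a₅).val) (v : ZMod p) :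
    e.1.getD (κ * v).val 0 =
      (if a₀ = v then 1 else 0) + (if a₁ = v then 1 else 0) + (if a₂ = v then 1 else 0) + (if a₃ = v then 1 else 0) +
        (if a₄ = v then 1 else 0) + (if a₅ = v then 1 else 0) := by
  rw [he, getD_cv6 p _ _ _ _ _ _ (ZMod.val_lt _), cnt6_scaled hκ]

/-- The count vector of the scaled tuple is the key of `κ·a`. [folklore] -/
theorem cv6_scaled_eq_key6 (κ : ZMod p) (a : Fin 6 → ZMod p) :
    cv6 p (κ * a 0).val (κ * a 1).val (κ * a 2).val (κ * a 3).val (κ * a 4).val (κ * a 5).val = key6 (fun i => κ * a i) :=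
  rfl

/-- **Normalisation**: a GOOD sextuple, scaled by a suitable unit, is a normalised repeated tuple with a non-excluded count
vector, so a table that passes `checkSix` has an entry keyed by it. [folklore] -/
theorem exists_entry_of_goodS {E : List (List ℕ)} (hE2 : ∀ k ∈ E, ∀ κ : ℕ, 1 ≤ κ → κ < p → scaleVec p κ k ∈ E)
    {T : List (List ℕ × List (ℕ × List ℕ))} {tt : BTree}
    (htt : ∀ x, tt.mem x = true → x ∈ T.map fun e => polyBE 7 e.1) (hWF : tabWF p 7 T = true)
    (hEwf : checkEwf6 p E = true) {et : BTree} (hEt' : ∀ x, et.mem x = true → x ∈ E.map (polyBE 7))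
    (hchk : checkSix p et tt = true) {a : Fin 6 → ZMod p} (h01 : a 0 = a 1) (hgood : key6 a ∉ E) :
    ∃ κ : ZMod p, κ ≠ 0 ∧ ∃ e ∈ T, ∀ v : ZMod p, e.1.getD (κ * v).val 0 =
      (if a 0 = v then 1 else 0) + (if a 1 = v then 1 else 0) + (if a 2 = v then 1 else 0) + (if a 3 = v then 1 else 0) +
        (if a 4 = v then 1 else 0) + (if a 5 = v then 1 else 0) := by
  have hp1 : Fact (1 < p) := ⟨(Fact.out : p.Prime).one_lt⟩
  simp only [checkSix, checkSixRow, checkSixRest, Bool.and_eq_true, List.all_eq_true, List.mem_range] at hchk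
  obtain ⟨hA, hB, hC, hD, hE5, hZ⟩ := hchk
  have hne : ∀ κ : ZMod p, κ ≠ 0 →
      cv6 p (κ * a 0).val (κ * a 1).val (κ * a 2).val (κ * a 3).val (κ * a 4).val (κ * a 5).val ∉ E :=
    fun κ hκ hmem => by
      rw [cv6_scaled_eq_key6] at hmem
      exact hgood (key6_mem_of_smul_mem hE2 hκ a hmem)
  -- generic finishing step: given a unit `κ` and a successful lookup of the scaled tuple
  have finish : ∀ κ : ZMod p, κ ≠ 0 →
      tt.mem (hornerS 7 (cv6 p (κ * a 0).val (κ * a 1).val (κ * a 2).val (κ * a 3).val (κ * a 4).val (κ * a 5).val) 0)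
        = true →
      ∃ κ : ZMod p, κ ≠ 0 ∧ ∃ e ∈ T, ∀ v : ZMod p, e.1.getD (κ * v).val 0 =
        (if a 0 = v then 1 else 0) + (if a 1 = v then 1 else 0) + (if a 2 = v then 1 else 0) + (if a 3 = v then 1 else 0) +
          (if a 4 = v then 1 else 0) + (if a 5 = v then 1 else 0) := by
    intro κ hκ hlook
    obtain ⟨e, he, hkey⟩ := entry_of_lookup6 htt hWF hlook
    exact ⟨κ, hκ, e, he, getD_entry_scaled6 hκ _ _ _ _ _ _ hkey⟩
  by_cases ha₀ : a 0 = 0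
  · have ha₁ : a 1 = 0 := h01 ▸ ha₀
    by_cases ha₂ : a 2 = 0
    · by_cases ha₃ : a 3 = 0
      · by_cases ha₄ : a 4 = 0
        · by_cases ha₅ : a 5 = 0
          · refine finish 1 one_ne_zero (lookup6_of_not_exc hEwf hEt' (hne 1 one_ne_zero) ?_)
            rw [ha₀, ha₁, ha₂, ha₃, ha₄, ha₅, mul_zero, ZMod.val_zero]; exact hZ
          · refine finish (a 5)⁻¹ (inv_ne_zero ha₅) (lookup6_of_not_exc hEwf hEt' (hne _ (inv_ne_zero ha₅)) ?_)
            rw [ha₀, ha₁, ha₂, ha₃, ha₄, mul_zero, ZMod.val_zero, inv_mul_cancel₀ ha₅, ZMod.val_one]; exact hE5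
        · refine finish (a 4)⁻¹ (inv_ne_zero ha₄) (lookup6_of_not_exc hEwf hEt' (hne _ (inv_ne_zero ha₄)) ?_)
          rw [ha₀, ha₁, ha₂, ha₃, mul_zero, ZMod.val_zero, inv_mul_cancel₀ ha₄, ZMod.val_one]
          exact hD _ (ZMod.val_lt _)
      · refine finish (a 3)⁻¹ (inv_ne_zero ha₃) (lookup6_of_not_exc hEwf hEt' (hne _ (inv_ne_zero ha₃)) ?_)
        rw [ha₀, ha₁, ha₂, mul_zero, ZMod.val_zero, inv_mul_cancel₀ ha₃, ZMod.val_one]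
        exact hC _ (ZMod.val_lt _) _ (ZMod.val_lt _)
    · refine finish (a 2)⁻¹ (inv_ne_zero ha₂) (lookup6_of_not_exc hEwf hEt' (hne _ (inv_ne_zero ha₂)) ?_)
      rw [ha₀, ha₁, mul_zero, ZMod.val_zero, inv_mul_cancel₀ ha₂, ZMod.val_one]
      exact hB _ (ZMod.val_lt _) _ (ZMod.val_lt _) _ (ZMod.val_lt _)
  · refine finish (a 0)⁻¹ (inv_ne_zero ha₀) (lookup6_of_not_exc hEwf hEt' (hne _ (inv_ne_zero ha₀)) ?_)
    rw [← h01, inv_mul_cancel₀ ha₀, ZMod.val_one]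
    exact hA _ (ZMod.val_lt _) _ (ZMod.val_lt _) _ (ZMod.val_lt _) _ (ZMod.val_lt _)

end Table

/-! ## Assembly -/

section Assembly

variable {p : ℕ} [Fact p.Prime]

/-- **Structural cover theorem for part `6`** (`p + 1 < 15`), all hypotheses on `E, R` as Bool checks plus the tree-completeness
and arrangement-completeness facts: every value function `g` of sum `6` on the `p²` points has a direction `j ≤ p`, a unit `k` and
an entry `e ∈ T` with `e.1[(k·v) % p] = (count of g along j at v)`. [folklore] -/
theorem exists_entry_structSix_of_checks (hp : p + 1 < 15) (E R : List (List ℕ)) (g₀ : ℕ) (et : BTree)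
    (YSa YSb : List (List ℕ)) (h1 : checkE1six E = true) (h2 : checkE2g p g₀ E = true) (hR : checkR6 p E R = true)
    (hEt : ∀ k ∈ E, et.mem (polyBE 7 k) = true)
    (hYSa : ∀ k ∈ R, ∀ ys ∈ arr6Y3 p k, ys ∈ YSa) (hYSb : ∀ k ∈ R, ∀ ys ∈ arr6Y2 p k, ys ∈ YSb)
    (h3a : ∀ k ∈ R, checkH6a p et YSa k = true) (h3b : ∀ k ∈ R, checkH6b p et YSb k = true)
    (T : List (List ℕ × List (ℕ × List ℕ))) (tt : BTree)
    (htt : ∀ x, tt.mem x = true → x ∈ T.map fun e => polyBE 7 e.1) (hWF : tabWF p 7 T = true)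
    (hEwf : checkEwf6 p E = true) (hEt' : ∀ x, et.mem x = true → x ∈ E.map (polyBE 7))
    (hchk : checkSix p et tt = true) (g : Fin (p * p) → ℕ) (hg : ∑ i, g i = 6) :
    ∃ j < p + 1, ∃ k : ℕ, k % p ≠ 0 ∧ ∃ e ∈ T, ∀ v < p,
      e.1.getD (k * v % p) 0 = ∑ i : Fin (p * p), pick v (pv p j i.val) (g i) := by
  haveI : NeZero p := ⟨(Fact.out : p.Prime).ne_zero⟩
  have hE1 := hE1six_of_check h1
  have hE2 := hE2_of_checkE2g h2
  have hR' := hR6_of_check hR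
  set H : ZMod p × ZMod p → ℕ := fun w => g ((ptEquiv p).symm w) with hH
  have hsum : ∑ w, H w = 6 := by
    rw [← hg]
    exact Fintype.sum_equiv (ptEquiv p).symm H g fun w => rfl
  obtain ⟨u, hu⟩ := exists_tuple_of_sum_eq 6 H hsum
  obtain ⟨j, hj, σ, h01, hgood⟩ := exists_goodS hp E hE1 hE2
    (h3a_of_checkH6a hE2 hR' hEt hYSa h3a) (h3b_of_checkH6b hE2 hR' hEt hYSb h3b) u
  have hcnt : ∀ v < p, ∑ i : Fin (p * p), pick v (pv p j i.val) (g i) =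
      ∑ i : Fin 6, if lineDir p j (u (σ i)) = ((v : ℕ) : ZMod p) then 1 else 0 := by
    intro v hv
    have e1 := sum_filter_eq_sum_pick p j H hv
    have e2 : ∀ i : Fin (p * p), H (pt p i.val) = g i := fun i => by
      show g ((ptEquiv p).symm (ptEquiv p i)) = g i
      rw [Equiv.symm_apply_apply]
    simp only [e2] at e1
    rw [← e1]
    simp only [hu]
    rw [sum_filter_tuple_count u (lineDir p j) ((v : ℕ) : ZMod p)]
    exact (Equiv.sum_comp σ (fun i => if lineDir p j (u i) = ((v : ℕ) : ZMod p) then 1 else 0)).symm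
  obtain ⟨κ, hκ, e, he, hev⟩ :=
    exists_entry_of_goodS hE2 htt hWF hEwf hEt' hchk (a := fun i => lineDir p j (u (σ i))) h01 hgood
  refine ⟨j, hj, κ.val, ?_, e, he, fun v hv => ?_⟩
  · rw [Nat.mod_eq_of_lt (ZMod.val_lt κ)]
    exact (ZMod.val_ne_zero κ).2 hκ
  · rw [hcnt v hv, Fin.sum_univ_six]
    have h1 := hev ((v : ℕ) : ZMod p)
    rw [ZMod.val_mul, ZMod.val_natCast, Nat.mod_eq_of_lt hv] at h1
    exact h1

end Assembly

end ZpZpDomino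

end Summit.MatrixMultiplication.OmegaCensus
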